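import Summits.QuantumFields.YangMills.Theorems.BalabanUVNodesN18HLayerW1Recursion
import Summits.QuantumFields.YangMills.Theorems.BalabanUVNodesN18HLayerW1Lemma3Config
import Summits.QuantumFields.YangMills.Theorems.BalabanUVNodesN18HLayerW1Thickened

/-!
# BalabanUVNodes ∕ N18 — THE H-LAYER ESTIMATE FOR W1's GENERATED TOWERS, LEVEL T: NODE A ∕ N10's deliverable AS A PER-TERM PROPERTY OF ONE STEP
# GENERATOR — «older terms obeying (1.18) and analytic on the tables ⟹ every generic term (2.14) of the step analytic on the next table, the activity
# dominated termwise, (2.26) per term» — through file 12's Lemma-3 socket into file 17's recursion: `RecAdmissible` discharged, (1.18) + [I] p. 263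
# analyticity + the (2.38) pair for `toClusterTower G`, L05 at the admissible pairing of record (Track A, DAG node N18 = NE5 `T4OutputRate.NE5 EA EB W κ θ C₅`
# :211; cluster K4 «SpineRates»; file 18 of seat pub-ymgap-dag-n18-c, row s1, generation 4; companion of file 17 `…N18HLayerW1Recursion`)

Cell `pub-ymgap`, HUMAN RULING D-0062 (Track A), R134 ACCELERATION seat `pub-ymgap-dag-n18-c` (strategy s1), generation 4.  THEOREMS ONLY (no `def`, no
`instance`, no `sorry`); imports file 17 `…N18HLayerW1Recursion` (p486412: the recursion-level induction from the per-generator schema (GEN)), file 12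
`…N18HLayerW1Lemma3Config` (p476890: `bound238_of_termwise226_config` over the kernel-checked socket `B13Lemma3TorusSocket`) and file 13 `…N18HLayerW1Thickened`
(p478698: the Cauchy margin); restates nothing.  Coefficient
algebra `𝔸 : Type` (the socket's `TwoTorusStep.Φ` lives in `Type`; the record's `M_N(ℂ)` qualifies).

WHY.  File 17 displays NODE A's majorant as (GEN)_k — a property of ONE generator `G k : W1.StepGen` at LEVEL H: admissible older terms ⟹ the new ACTIVITIES
`(G k).H t old · Z` analytic and (2.38)-bounded on the next table.  [II] delivers it one printed level lower, PER GENERIC TERM (2.14): «We consider it as an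
analytic function of (𝐔,𝐉) in the space U^c_{k+1}(X, α₀, α₁)» (p. 15) and the bound (2.26) p. 17 — both through `|V_k(Y, ·)|`, i.e. through the OLDER TERMS
((2.15), (1.41)–(1.43)) — and Lemma 3 pp. 17–20 resums (2.26) over the torus term catalogue to (2.38).  The resummation is the tree's theorem (file 12 §2
`bound238_of_termwise226_config` ∘ `B13Lemma3TorusSocket.hRep_of_termwise` ∘ `h238_of_hRep_half`); the finite sum of analytic terms is analytic.  So the schema
N10 can literally instantiate, generator by generator, is
  (GEN-T)_k  for every last coupling `t ∈ D` and every older-term table `old` obeying (1.18)`(E₀, r₁)` on the tables `sp j`, `j ≤ k`, and analytic there: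
             every generic term `φ ↦ (G k).T i t old φ`, `i ∈ idx Z`, is analytic at the points of `sp (k+1) Z`; the activity is dominated termwise
             `‖(G k).H t old φ Z‖ ≤ Σ_{τ ∈ terms L M Z} ‖Tm k t old Z τ φ‖` by term maps `Tm` over the socket's catalogue; and (2.26) per term
             `‖Tm k t old Z τ φ‖ ≤ weight(τ)·e^{a₅|Z|}` on `sp (k+1) Z`                                                                     (DISPLAYED)
and THIS FILE proves (GEN-T) ⟹ (GEN) (ONE `Lemma3Numerics` bundle, `A = C₃ε₁`, `R = (1 − 8δ)·½L·κ`) and feeds file 17.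

WHAT (theorems only; `F.P K`, d = 4 numerals; located rate clause `r₁ + 2·64·log 162 + 2 ≤ (1−8δ)·½L·κ`, STRICT [KP86] clause at `C₃ε₁`, renewal
`e·9·64·K₀(64,8)²·C₃ε₁ ≤ E₀`).
* §1 ★ `stepGen_of_stepGenT` — (GEN-T) ⟹ (GEN): the finite sum of analytic terms (`Finset.analyticOnNhd_sum`) and file 12 §2 run on the one-step cluster data
  `⟨Idx, idx, i ↦ T i t old⟩` (young prefix inert), whose activity IS `(G k).H t old` — Lemma 3's resummation BY NAME.
* §2 `recTerm_inductiveAssumptions_of_stepGenT`, ★ `recAdmissible_of_stepGenT`, `termBound118_toClusterTower_of_stepGenT`, `termAnalytic_toClusterTower_of_stepGenT`,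
  ★ `hLayer_toClusterTower_of_stepGenT` (the pair `AnalyticH ∧ Bound238 … (C₃ε₁) ((1−8δ)·½L·κ)` at every step of the generated tower) — file 17 §1–§2 fed by §1.
* §3 ★ `decayBound_EA_ofRecordAdm_toClusterTower_of_stepGenT` — L05 of the END at `LevelPairing.ofRecordAdm` for the generated tower from (GEN-T) + the
  tables' restriction property + ONE numerics bundle ALONE.
* §4 ★ `analyticInEachOfRecord_toClusterTower_of_stepGen` — [I] p. 266 (analytic in EVERY young coupling) for the generated tower: node00-def-W1's
  `analyticInEachOfRecord_toClusterTower` with its `RecAdmissible` hypothesis DISCHARGED by file 17 — three per-generator schemas (GEN), (A-last), (A-prop),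
  nothing assumed of the tower.
* §5 `termDerivBound_toClusterTower_of_stepGen_thickening` — (1.17) at the table for the generated tower from (GEN) on its `ρ`-thickening (file 13's margin):
  with file 17 §2, all three printed inductive assumptions of [I] p. 263 for `toClusterTower G` from the one per-generator schema.

HONEST FRAMING — what this is NOT.  Count-neutral by-name knit AT THE OBJECT; NOT a discharge of N18 (typed 28∕28 · discharged 5∕27 UNCHANGED).  (GEN-T) is
DISPLAYED and asserted nowhere: it is [II] (2.14)–(2.26) for THE generator of record (N10's Lemmas 1–2 ∕ NODE A's majorant on the class (1.5), the (1.41)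
factorisation through the potentials inside `T`); the identification of the generator's abstract index `Idx` with the socket's catalogue (the term maps
`Tm`), the generator, the coupling domain, the tables and the letters are data.  THE COUPLING DOMAIN `D ⊂ ℂ` IS A PARAMETER: print's content ((2.14)–(2.38)
at REAL young couplings) is (GEN-T) ∕ (GEN) for `D := ↑]0, γ]`, which is all §2–§3 ∕ §5 use (`hD`); for an OPEN `D ⊂ ℂ` (as node00-def-W1's Road 3 in §4
wants) the schema at complex last coupling is the last-coupling complexification — [I] p. 263 «(or analytic)», the N22 ∕ N09 lanes' content, NOT [II] as
printed.  NE5 (two-run content) untouched: NOT IN PRINT, NOT PROVED.  One finite four-torus programme at fixed `ε`, Bałaban as printed — NOT the continuum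
limit on ℝ⁴, NOT infinite volume, NOT OS, NOT a mass gap, NOT Clay.  0 `sorry`, 0 `def`; axioms standard.

References (TYPES ∕ loci only): [I] = [Balaban1987RG1] CMP **109** (1987) — (0.25) p. 257, Thm 1 p. 259, (1.18) and the analyticity sentence p. 263,
(2.12)–(2.13) p. 268; [II] = [Balaban1988RG2Cluster] CMP **116** (1988) — (1.41)–(1.43) p. 11, (2.9)–(2.11) p. 14, (2.14)–(2.15) p. 15, (2.26) p. 17, Lemma 3
(2.38) p. 20, (2.41) p. 21, p. 22; [KoteckyPreiss1986] Thm 1 p. 492.  Nothing here is a claim about the Yang–Mills mass gap.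
-/

noncomputable section

namespace Summit.QuantumFields.YangMills.BalabanUVNodes.N18HLayerW1RecursionTerms

open Set Metric
open scoped BigOperators
open Literature.MathematicalPhysics.QuantumFieldTheory.Balaban1983to89
open Literature.MathematicalPhysics.QuantumFieldTheory.Balaban1983to89.T4Continuum (T4Family)
open Literature.MathematicalPhysics.QuantumFieldTheory.Balaban1983to89.T4OutputRate
open Literature.MathematicalPhysics.QuantumFieldTheory.Balaban1983to89.TreeLengthTorus (TDom)
open Literature.MathematicalPhysics.QuantumFieldTheory.Balaban1983to89.B12TreeDecay (K₀)
open Literature.MathematicalPhysics.QuantumFieldTheory.Balaban1983to89.B13Lemma3TorusData (TBond)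
open Literature.MathematicalPhysics.QuantumFieldTheory.Balaban1983to89.B13Lemma3TorusTerms (terms weight)
open Literature.MathematicalPhysics.QuantumFieldTheory.Balaban1983to89.B13Lemma3TorusSocket (Lemma3Numerics)
open Literature.MathematicalPhysics.QuantumFieldTheory.Balaban1983to89.Node00
open Literature.MathematicalPhysics.QuantumFieldTheory.Balaban1983to89.Node00.Sect2 (domSys domCount CPair ofBackgroundC)
open Literature.MathematicalPhysics.QuantumFieldTheory.Balaban1983to89.Node00.W1
open Summit.QuantumFields.YangMills.BalabanUVNodes.N18HLayerW1Lemma3Config (bound238_of_termwise226_config)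
open Summit.QuantumFields.YangMills.BalabanUVNodes.N18HLayerW1Thickened (spRestr_thickening termDerivBound_of_bound238_thickening)
open Summit.QuantumFields.YangMills.BalabanUVNodes.N18HLayerW1Recursion (recTerm_inductiveAssumptions_of_stepGen recAdmissible_of_stepGen
  termBound118_toClusterTower_of_stepGen termAnalytic_toClusterTower_of_stepGen hLayer_toClusterTower_of_stepGen
  decayBound_EA_ofRecordAdm_toClusterTower_of_stepGen)

/-! ## §1 (GEN-T) ⟹ (GEN): the finite sum of analytic terms; Lemma 3's resummation by file 12 on the one-step data `⟨Idx, idx, T · t old⟩` -/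

section StepT

variable (F : T4Family) (K : ℕ) {𝔸 : Type} [NormedRing 𝔸] [NormedAlgebra ℂ 𝔸] {M : ℕ} [NeZero M]

open Classical in
/-- **★ (GEN-T) ⟹ (GEN) — NODE A's PER-TERM CONDITIONAL DATA RESUMMED TO THE ACTIVITY LEVEL, GENERATOR BY GENERATOR.**  For a generator tower `G` on `F.P K`,
a coupling domain `D`, a table family `sp`, letters `E₀, r₁`, the socket's constants `c` with ONE numerics bundle `Lemma3Numerics c M (½L) …` (`8 ≤ L`), and
term maps `Tm k t old Z τ : Φ → ℂ` over the torus term catalogue `terms L M Z` (data): IF at every step `k`, for every `t ∈ D` and every older-term table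
`old` obeying (1.18)`(E₀, r₁)` and analytic on the tables `sp j` (`j ≤ k`), (i) every generic term `φ ↦ (G k).T i t old φ`, `i ∈ (G k).idx Z`, is analytic at
the points of `sp (k+1) Z` ((2.14) p. 15), (ii) `‖(G k).H t old φ Z‖ ≤ Σ_{τ ∈ terms L M Z} ‖Tm k t old Z τ φ‖` on `sp (k+1) Z` ((2.9)∕(2.14): the activity is
the sum of its terms), (iii) `‖Tm k t old Z τ φ‖ ≤ weight L M c Z a τ · e^{a₅|Z|}` on `sp (k+1) Z` ((2.26) p. 17) — (GEN-T), DISPLAYED — THEN (GEN) holds with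
`A = C₃ε₁`, `R = (1 − 8δ)·½L·κ`: the activities are analytic (finite sum) and (2.38)-bounded (file 12's `bound238_of_termwise226_config` on the one-step
cluster data `⟨Idx, idx, i ↦ T i t old⟩`, young prefix inert, whose activity IS `(G k).H t old`). [cite: Balaban1988RG2Cluster, (2.9)-(2.11) p.14, (2.14) p.15, (2.26) p.17 and Lemma 3 (2.38) p.20] -/
theorem stepGen_of_stepGenT (G : GenTower (F.P K) 𝔸 M) (D : Set ℂ) (sp : (j : ℕ) → (domSys (F.P K) M j).Dom → Set (CPair (F.P K) 𝔸))
    {E₀ r₁ : ℝ} (c : B13.Consts) {L : ℕ} [NeZero L] (hL : 8 ≤ c.L) (hLc : c.L = L) {a a₂ a₂' a₅ Aabs : ℝ}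
    (hN : Lemma3Numerics c M ((c.L : ℝ) / 2) a a₂ a₂' a₅ Aabs)
    (Tm : (k : ℕ) → ℂ → OlderTerms (F.P K) 𝔸 M k → (Z : TDom 4 (domCount (F.P K) M (k + 1))) →
      Finset (TDom 4 (L * domCount (F.P K) M (k + 1))) × Finset (TBond 4 M (L * domCount (F.P K) M (k + 1))) → CPair (F.P K) 𝔸 → ℂ)
    (hgenT : ∀ k : ℕ, ∀ t ∈ D, ∀ old : OlderTerms (F.P K) 𝔸 M k,
      (∀ (j : Fin (k + 1)) (Y : (domSys (F.P K) M j).Dom), ∀ ψ ∈ sp j Y,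
          ‖old j Y ψ‖ ≤ E₀ * Real.exp (-(r₁ * (domSys (F.P K) M j).dj Y))) →
      (∀ (j : Fin (k + 1)) (Y : (domSys (F.P K) M j).Dom), AnalyticOnNhd ℂ (old j Y) (sp j Y)) →
      (∀ (Z : (domSys (F.P K) M (k + 1)).Dom), ∀ i ∈ (G k).idx Z, AnalyticOnNhd ℂ (fun φ => (G k).T i t old φ) (sp (k + 1) Z)) ∧
      (∀ (Z : (domSys (F.P K) M (k + 1)).Dom) (φ : CPair (F.P K) 𝔸), φ ∈ sp (k + 1) Z →
          ‖(G k).H t old φ Z‖ ≤ ∑ τ ∈ terms L M Z, ‖Tm k t old Z τ φ‖) ∧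
      (∀ (Z : (domSys (F.P K) M (k + 1)).Dom) (φ : CPair (F.P K) 𝔸), φ ∈ sp (k + 1) Z → ∀ τ ∈ terms L M Z,
          ‖Tm k t old Z τ φ‖ ≤ weight L M c Z a τ * Real.exp (a₅ * ((Z.1).card : ℝ)))) :
    ∀ k : ℕ, ∀ t ∈ D, ∀ old : OlderTerms (F.P K) 𝔸 M k,
      (∀ (j : Fin (k + 1)) (Y : (domSys (F.P K) M j).Dom), ∀ ψ ∈ sp j Y,
          ‖old j Y ψ‖ ≤ E₀ * Real.exp (-(r₁ * (domSys (F.P K) M j).dj Y))) →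
      (∀ (j : Fin (k + 1)) (Y : (domSys (F.P K) M j).Dom), AnalyticOnNhd ℂ (old j Y) (sp j Y)) →
      (∀ Z : (domSys (F.P K) M (k + 1)).Dom, AnalyticOnNhd ℂ (fun φ => (G k).H t old φ Z) (sp (k + 1) Z)) ∧
      (∀ (Z : (domSys (F.P K) M (k + 1)).Dom), ∀ φ ∈ sp (k + 1) Z,
          ‖(G k).H t old φ Z‖ ≤ c.C3act * c.ε₁ * Real.exp (-((1 - 8 * c.δ) * ((c.L : ℝ) / 2) * c.κ * (domSys (F.P K) M (k + 1)).dj Z))) := by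
  intro k t ht old hB hAn
  obtain ⟨hT, hdom, h226⟩ := hgenT k t ht old hB hAn
  refine ⟨fun Z => ?_, fun Z φ hφ => ?_⟩
  · -- (2.11): the activity is the finite sum of its analytic terms
    have h := Finset.analyticOnNhd_sum ((G k).idx Z) (f := fun i φ => (G k).T i t old φ) fun i hi => hT Z i hi
    rw [Finset.sum_fn] at h
    simpa only [StepGen.H] using h
  · -- Lemma 3 by file 12 on the one-step cluster data with the young prefix inert
    have h238 := bound238_of_termwise226_config F K
      (⟨(G k).Idx, (G k).idx, fun i _ φ => (G k).T i t old φ⟩ : ClusterStep (F.P K) 𝔸 M k) (Set.univ : Set (Fin (k + 1) → ℝ))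
      (sp (k + 1)) c hL hLc hN (fun _ Z τ φ => Tm k t old Z τ φ) (fun _ _ Z φ hφ => hdom Z φ hφ) (fun _ _ Z φ hφ τ hτ => h226 Z φ hφ τ hτ)
    exact h238 (fun _ => 0) (Set.mem_univ _) Z φ hφ

end StepT

/-! ## §2 File 17 fed by §1: both inductive assumptions for every generated term, `RecAdmissible`, the real reading -/

section Recursion

variable (F : T4Family) (K : ℕ) {𝔸 : Type} [NormedRing 𝔸] [NormedAlgebra ℂ 𝔸] {M : ℕ} [NeZero M]

open Classical in
/-- **BOTH INDUCTIVE ASSUMPTIONS FOR EVERY GENERATED TERM FROM (GEN-T)**: for every coupling history `g` with values in `D`, every level `j` and domain `X`,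
`‖recTerm G g j X φ‖ ≤ E₀·e^{−r₁ d_j(X)}` on `sp j X` and `recTerm G g j X` analytic at every point of `sp j X` (file 17 §1 ∘ §1).
[cite: Balaban1987RG1, Thm 1 p.259, (1.18) p.263 and (2.12)-(2.13) p.268; Balaban1988RG2Cluster, (2.14) p.15, (2.26) p.17, Lemma 3 (2.38) p.20, (2.41) p.21, p.22] -/
theorem recTerm_inductiveAssumptions_of_stepGenT (G : GenTower (F.P K) 𝔸 M) (D : Set ℂ)
    (sp : (j : ℕ) → (domSys (F.P K) M j).Dom → Set (CPair (F.P K) 𝔸)) {E₀ r₁ : ℝ} (hrestr : ∀ k, W1.SpRestr (sp (k + 1)))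
    (c : B13.Consts) {L : ℕ} [NeZero L] (hL : 8 ≤ c.L) (hLc : c.L = L) {a a₂ a₂' a₅ Aabs : ℝ}
    (hN : Lemma3Numerics c M ((c.L : ℝ) / 2) a a₂ a₂' a₅ Aabs)
    (Tm : (k : ℕ) → ℂ → OlderTerms (F.P K) 𝔸 M k → (Z : TDom 4 (domCount (F.P K) M (k + 1))) →
      Finset (TDom 4 (L * domCount (F.P K) M (k + 1))) × Finset (TBond 4 M (L * domCount (F.P K) M (k + 1))) → CPair (F.P K) 𝔸 → ℂ)
    (hgenT : ∀ k : ℕ, ∀ t ∈ D, ∀ old : OlderTerms (F.P K) 𝔸 M k,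
      (∀ (j : Fin (k + 1)) (Y : (domSys (F.P K) M j).Dom), ∀ ψ ∈ sp j Y,
          ‖old j Y ψ‖ ≤ E₀ * Real.exp (-(r₁ * (domSys (F.P K) M j).dj Y))) →
      (∀ (j : Fin (k + 1)) (Y : (domSys (F.P K) M j).Dom), AnalyticOnNhd ℂ (old j Y) (sp j Y)) →
      (∀ (Z : (domSys (F.P K) M (k + 1)).Dom), ∀ i ∈ (G k).idx Z, AnalyticOnNhd ℂ (fun φ => (G k).T i t old φ) (sp (k + 1) Z)) ∧
      (∀ (Z : (domSys (F.P K) M (k + 1)).Dom) (φ : CPair (F.P K) 𝔸), φ ∈ sp (k + 1) Z →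
          ‖(G k).H t old φ Z‖ ≤ ∑ τ ∈ terms L M Z, ‖Tm k t old Z τ φ‖) ∧
      (∀ (Z : (domSys (F.P K) M (k + 1)).Dom) (φ : CPair (F.P K) 𝔸), φ ∈ sp (k + 1) Z → ∀ τ ∈ terms L M Z,
          ‖Tm k t old Z τ φ‖ ≤ weight L M c Z a τ * Real.exp (a₅ * ((Z.1).card : ℝ))))
    (hr₁ : 0 ≤ r₁) (hA : 0 ≤ c.C3act * c.ε₁) (hrate : r₁ + 2 * (64 * Real.log 162) + 2 ≤ (1 - 8 * c.δ) * ((c.L : ℝ) / 2) * c.κ)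
    (hsmall : c.C3act * c.ε₁ * Real.exp (5 * r₁ + 1) * K₀ 64 8 * 9 * 64 < 1)
    (hrenew : Real.exp 1 * 9 * 64 * K₀ 64 8 ^ 2 * (c.C3act * c.ε₁) ≤ E₀) (g : ℕ → ℂ) (hg : ∀ n, g n ∈ D) :
    ∀ (j : ℕ) (X : (domSys (F.P K) M j).Dom),
      (∀ φ ∈ sp j X, ‖recTerm G g j X φ‖ ≤ E₀ * Real.exp (-(r₁ * (domSys (F.P K) M j).dj X))) ∧
      AnalyticOnNhd ℂ (recTerm G g j X) (sp j X) :=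
  recTerm_inductiveAssumptions_of_stepGen F K G D sp hrestr (stepGen_of_stepGenT F K G D sp c hL hLc hN Tm hgenT) hA hr₁ hrate hsmall
    hrenew g hg

open Classical in
/-- **★ node00-def-W1's `RecAdmissible` DISCHARGED FROM (GEN-T)** for the class «(1.18)`(E₀, r₁)` on the tables and analytic there» (file 17 §1 ∘ §1).
[cite: Balaban1987RG1, §1 p.263 (the inductive assumptions) and Thm 1 p.259; Balaban1988RG2Cluster, (2.14) p.15, (2.26) p.17 and p.22] -/
theorem recAdmissible_of_stepGenT (G : GenTower (F.P K) 𝔸 M) (D : Set ℂ)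
    (sp : (j : ℕ) → (domSys (F.P K) M j).Dom → Set (CPair (F.P K) 𝔸)) {E₀ r₁ : ℝ} (hrestr : ∀ k, W1.SpRestr (sp (k + 1)))
    (c : B13.Consts) {L : ℕ} [NeZero L] (hL : 8 ≤ c.L) (hLc : c.L = L) {a a₂ a₂' a₅ Aabs : ℝ}
    (hN : Lemma3Numerics c M ((c.L : ℝ) / 2) a a₂ a₂' a₅ Aabs)
    (Tm : (k : ℕ) → ℂ → OlderTerms (F.P K) 𝔸 M k → (Z : TDom 4 (domCount (F.P K) M (k + 1))) →
      Finset (TDom 4 (L * domCount (F.P K) M (k + 1))) × Finset (TBond 4 M (L * domCount (F.P K) M (k + 1))) → CPair (F.P K) 𝔸 → ℂ)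
    (hgenT : ∀ k : ℕ, ∀ t ∈ D, ∀ old : OlderTerms (F.P K) 𝔸 M k,
      (∀ (j : Fin (k + 1)) (Y : (domSys (F.P K) M j).Dom), ∀ ψ ∈ sp j Y,
          ‖old j Y ψ‖ ≤ E₀ * Real.exp (-(r₁ * (domSys (F.P K) M j).dj Y))) →
      (∀ (j : Fin (k + 1)) (Y : (domSys (F.P K) M j).Dom), AnalyticOnNhd ℂ (old j Y) (sp j Y)) →
      (∀ (Z : (domSys (F.P K) M (k + 1)).Dom), ∀ i ∈ (G k).idx Z, AnalyticOnNhd ℂ (fun φ => (G k).T i t old φ) (sp (k + 1) Z)) ∧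
      (∀ (Z : (domSys (F.P K) M (k + 1)).Dom) (φ : CPair (F.P K) 𝔸), φ ∈ sp (k + 1) Z →
          ‖(G k).H t old φ Z‖ ≤ ∑ τ ∈ terms L M Z, ‖Tm k t old Z τ φ‖) ∧
      (∀ (Z : (domSys (F.P K) M (k + 1)).Dom) (φ : CPair (F.P K) 𝔸), φ ∈ sp (k + 1) Z → ∀ τ ∈ terms L M Z,
          ‖Tm k t old Z τ φ‖ ≤ weight L M c Z a τ * Real.exp (a₅ * ((Z.1).card : ℝ))))
    (hr₁ : 0 ≤ r₁) (hA : 0 ≤ c.C3act * c.ε₁) (hrate : r₁ + 2 * (64 * Real.log 162) + 2 ≤ (1 - 8 * c.δ) * ((c.L : ℝ) / 2) * c.κ)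
    (hsmall : c.C3act * c.ε₁ * Real.exp (5 * r₁ + 1) * K₀ 64 8 * 9 * 64 < 1)
    (hrenew : Real.exp 1 * 9 * 64 * K₀ 64 8 ^ 2 * (c.C3act * c.ε₁) ≤ E₀) :
    RecAdmissible G D fun k => {old : OlderTerms (F.P K) 𝔸 M k |
      (∀ (j : Fin (k + 1)) (Y : (domSys (F.P K) M j).Dom), ∀ ψ ∈ sp j Y,
          ‖old j Y ψ‖ ≤ E₀ * Real.exp (-(r₁ * (domSys (F.P K) M j).dj Y))) ∧
      (∀ (j : Fin (k + 1)) (Y : (domSys (F.P K) M j).Dom), AnalyticOnNhd ℂ (old j Y) (sp j Y))} :=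
  recAdmissible_of_stepGen F K G D sp hrestr (stepGen_of_stepGenT F K G D sp c hL hLc hN Tm hgenT) hA hr₁ hrate hsmall hrenew

open Classical in
/-- **(1.18) FOR THE GENERATED TOWER FROM (GEN-T)**: `W1.TermBound118 (toClusterTower G) W sp E₀ r₁` for histories read inside `D`.
[cite: Balaban1987RG1, (1.18) p.263 and Thm 1 p.259; Balaban1988RG2Cluster, (2.26) p.17, Lemma 3 (2.38) p.20, (2.41) p.21] -/
theorem termBound118_toClusterTower_of_stepGenT (G : GenTower (F.P K) 𝔸 M) (D : Set ℂ)
    (sp : (j : ℕ) → (domSys (F.P K) M j).Dom → Set (CPair (F.P K) 𝔸)) {E₀ r₁ : ℝ} (hrestr : ∀ k, W1.SpRestr (sp (k + 1)))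
    (c : B13.Consts) {L : ℕ} [NeZero L] (hL : 8 ≤ c.L) (hLc : c.L = L) {a a₂ a₂' a₅ Aabs : ℝ}
    (hN : Lemma3Numerics c M ((c.L : ℝ) / 2) a a₂ a₂' a₅ Aabs)
    (Tm : (k : ℕ) → ℂ → OlderTerms (F.P K) 𝔸 M k → (Z : TDom 4 (domCount (F.P K) M (k + 1))) →
      Finset (TDom 4 (L * domCount (F.P K) M (k + 1))) × Finset (TBond 4 M (L * domCount (F.P K) M (k + 1))) → CPair (F.P K) 𝔸 → ℂ)
    (hgenT : ∀ k : ℕ, ∀ t ∈ D, ∀ old : OlderTerms (F.P K) 𝔸 M k,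
      (∀ (j : Fin (k + 1)) (Y : (domSys (F.P K) M j).Dom), ∀ ψ ∈ sp j Y,
          ‖old j Y ψ‖ ≤ E₀ * Real.exp (-(r₁ * (domSys (F.P K) M j).dj Y))) →
      (∀ (j : Fin (k + 1)) (Y : (domSys (F.P K) M j).Dom), AnalyticOnNhd ℂ (old j Y) (sp j Y)) →
      (∀ (Z : (domSys (F.P K) M (k + 1)).Dom), ∀ i ∈ (G k).idx Z, AnalyticOnNhd ℂ (fun φ => (G k).T i t old φ) (sp (k + 1) Z)) ∧
      (∀ (Z : (domSys (F.P K) M (k + 1)).Dom) (φ : CPair (F.P K) 𝔸), φ ∈ sp (k + 1) Z →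
          ‖(G k).H t old φ Z‖ ≤ ∑ τ ∈ terms L M Z, ‖Tm k t old Z τ φ‖) ∧
      (∀ (Z : (domSys (F.P K) M (k + 1)).Dom) (φ : CPair (F.P K) 𝔸), φ ∈ sp (k + 1) Z → ∀ τ ∈ terms L M Z,
          ‖Tm k t old Z τ φ‖ ≤ weight L M c Z a τ * Real.exp (a₅ * ((Z.1).card : ℝ))))
    (hr₁ : 0 ≤ r₁) (hA : 0 ≤ c.C3act * c.ε₁) (hrate : r₁ + 2 * (64 * Real.log 162) + 2 ≤ (1 - 8 * c.δ) * ((c.L : ℝ) / 2) * c.κ)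
    (hsmall : c.C3act * c.ε₁ * Real.exp (5 * r₁ + 1) * K₀ 64 8 * 9 * 64 < 1)
    (hrenew : Real.exp 1 * 9 * 64 * K₀ 64 8 ^ 2 * (c.C3act * c.ε₁) ≤ E₀)
    (W : Set (ℕ → ℝ)) (hW : ∀ g ∈ W, ∀ n, ((g n : ℝ) : ℂ) ∈ D) :
    TermBound118 (toClusterTower G) W sp E₀ r₁ :=
  termBound118_toClusterTower_of_stepGen F K G D sp hrestr (stepGen_of_stepGenT F K G D sp c hL hLc hN Tm hgenT) hA hr₁ hrate hsmall
    hrenew W hW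

open Classical in
/-- **[I] p. 263 ANALYTICITY FOR THE GENERATED TOWER FROM (GEN-T)**: `W1.TermAnalytic (toClusterTower G) W sp`.
[cite: Balaban1987RG1, §1 p.263 (analytic on U^c_j) and Thm 1 p.259; Balaban1988RG2Cluster, (2.14) p.15] -/
theorem termAnalytic_toClusterTower_of_stepGenT (G : GenTower (F.P K) 𝔸 M) (D : Set ℂ)
    (sp : (j : ℕ) → (domSys (F.P K) M j).Dom → Set (CPair (F.P K) 𝔸)) {E₀ r₁ : ℝ} (hrestr : ∀ k, W1.SpRestr (sp (k + 1)))
    (c : B13.Consts) {L : ℕ} [NeZero L] (hL : 8 ≤ c.L) (hLc : c.L = L) {a a₂ a₂' a₅ Aabs : ℝ}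
    (hN : Lemma3Numerics c M ((c.L : ℝ) / 2) a a₂ a₂' a₅ Aabs)
    (Tm : (k : ℕ) → ℂ → OlderTerms (F.P K) 𝔸 M k → (Z : TDom 4 (domCount (F.P K) M (k + 1))) →
      Finset (TDom 4 (L * domCount (F.P K) M (k + 1))) × Finset (TBond 4 M (L * domCount (F.P K) M (k + 1))) → CPair (F.P K) 𝔸 → ℂ)
    (hgenT : ∀ k : ℕ, ∀ t ∈ D, ∀ old : OlderTerms (F.P K) 𝔸 M k,
      (∀ (j : Fin (k + 1)) (Y : (domSys (F.P K) M j).Dom), ∀ ψ ∈ sp j Y,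
          ‖old j Y ψ‖ ≤ E₀ * Real.exp (-(r₁ * (domSys (F.P K) M j).dj Y))) →
      (∀ (j : Fin (k + 1)) (Y : (domSys (F.P K) M j).Dom), AnalyticOnNhd ℂ (old j Y) (sp j Y)) →
      (∀ (Z : (domSys (F.P K) M (k + 1)).Dom), ∀ i ∈ (G k).idx Z, AnalyticOnNhd ℂ (fun φ => (G k).T i t old φ) (sp (k + 1) Z)) ∧
      (∀ (Z : (domSys (F.P K) M (k + 1)).Dom) (φ : CPair (F.P K) 𝔸), φ ∈ sp (k + 1) Z →
          ‖(G k).H t old φ Z‖ ≤ ∑ τ ∈ terms L M Z, ‖Tm k t old Z τ φ‖) ∧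
      (∀ (Z : (domSys (F.P K) M (k + 1)).Dom) (φ : CPair (F.P K) 𝔸), φ ∈ sp (k + 1) Z → ∀ τ ∈ terms L M Z,
          ‖Tm k t old Z τ φ‖ ≤ weight L M c Z a τ * Real.exp (a₅ * ((Z.1).card : ℝ))))
    (hr₁ : 0 ≤ r₁) (hA : 0 ≤ c.C3act * c.ε₁) (hrate : r₁ + 2 * (64 * Real.log 162) + 2 ≤ (1 - 8 * c.δ) * ((c.L : ℝ) / 2) * c.κ)
    (hsmall : c.C3act * c.ε₁ * Real.exp (5 * r₁ + 1) * K₀ 64 8 * 9 * 64 < 1)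
    (hrenew : Real.exp 1 * 9 * 64 * K₀ 64 8 ^ 2 * (c.C3act * c.ε₁) ≤ E₀)
    (W : Set (ℕ → ℝ)) (hW : ∀ g ∈ W, ∀ n, ((g n : ℝ) : ℂ) ∈ D) :
    TermAnalytic (toClusterTower G) W sp :=
  termAnalytic_toClusterTower_of_stepGen F K G D sp hrestr (stepGen_of_stepGenT F K G D sp c hL hLc hN Tm hgenT) hA hr₁ hrate hsmall
    hrenew W hW

open Classical in
/-- **★ THE (2.38) PAIR AT EVERY STEP OF THE GENERATED TOWER FROM (GEN-T)** — `(toClusterTower G k).AnalyticH (box γ k) (sp (k+1)) ∧ .Bound238 (box γ k)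
(sp (k+1)) (C₃ε₁) ((1−8δ)·½L·κ)` for every `k` (window `]0, γ]` read inside `D`): the per-step hypotheses of files 9–13 and of dag-n18-d's N18 junctions
PRODUCED for generated towers from NODE A's per-term conditional data. [cite: Balaban1988RG2Cluster, (2.14) p.15, (2.26) p.17 and Lemma 3 (2.38) p.20; Balaban1987RG1, Thm 1 p.259] -/
theorem hLayer_toClusterTower_of_stepGenT (G : GenTower (F.P K) 𝔸 M) (D : Set ℂ)
    (sp : (j : ℕ) → (domSys (F.P K) M j).Dom → Set (CPair (F.P K) 𝔸)) {E₀ r₁ γ : ℝ} (hrestr : ∀ k, W1.SpRestr (sp (k + 1)))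
    (c : B13.Consts) {L : ℕ} [NeZero L] (hL : 8 ≤ c.L) (hLc : c.L = L) {a a₂ a₂' a₅ Aabs : ℝ}
    (hN : Lemma3Numerics c M ((c.L : ℝ) / 2) a a₂ a₂' a₅ Aabs)
    (Tm : (k : ℕ) → ℂ → OlderTerms (F.P K) 𝔸 M k → (Z : TDom 4 (domCount (F.P K) M (k + 1))) →
      Finset (TDom 4 (L * domCount (F.P K) M (k + 1))) × Finset (TBond 4 M (L * domCount (F.P K) M (k + 1))) → CPair (F.P K) 𝔸 → ℂ)
    (hgenT : ∀ k : ℕ, ∀ t ∈ D, ∀ old : OlderTerms (F.P K) 𝔸 M k,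
      (∀ (j : Fin (k + 1)) (Y : (domSys (F.P K) M j).Dom), ∀ ψ ∈ sp j Y,
          ‖old j Y ψ‖ ≤ E₀ * Real.exp (-(r₁ * (domSys (F.P K) M j).dj Y))) →
      (∀ (j : Fin (k + 1)) (Y : (domSys (F.P K) M j).Dom), AnalyticOnNhd ℂ (old j Y) (sp j Y)) →
      (∀ (Z : (domSys (F.P K) M (k + 1)).Dom), ∀ i ∈ (G k).idx Z, AnalyticOnNhd ℂ (fun φ => (G k).T i t old φ) (sp (k + 1) Z)) ∧
      (∀ (Z : (domSys (F.P K) M (k + 1)).Dom) (φ : CPair (F.P K) 𝔸), φ ∈ sp (k + 1) Z →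
          ‖(G k).H t old φ Z‖ ≤ ∑ τ ∈ terms L M Z, ‖Tm k t old Z τ φ‖) ∧
      (∀ (Z : (domSys (F.P K) M (k + 1)).Dom) (φ : CPair (F.P K) 𝔸), φ ∈ sp (k + 1) Z → ∀ τ ∈ terms L M Z,
          ‖Tm k t old Z τ φ‖ ≤ weight L M c Z a τ * Real.exp (a₅ * ((Z.1).card : ℝ))))
    (hr₁ : 0 ≤ r₁) (hA : 0 ≤ c.C3act * c.ε₁) (hrate : r₁ + 2 * (64 * Real.log 162) + 2 ≤ (1 - 8 * c.δ) * ((c.L : ℝ) / 2) * c.κ)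
    (hsmall : c.C3act * c.ε₁ * Real.exp (5 * r₁ + 1) * K₀ 64 8 * 9 * 64 < 1)
    (hrenew : Real.exp 1 * 9 * 64 * K₀ 64 8 ^ 2 * (c.C3act * c.ε₁) ≤ E₀)
    (hD : ∀ s ∈ Ioc (0 : ℝ) γ, ((s : ℝ) : ℂ) ∈ D) :
    ∀ k, (toClusterTower G k).AnalyticH (box γ k) (sp (k + 1)) ∧
      (toClusterTower G k).Bound238 (box γ k) (sp (k + 1)) (c.C3act * c.ε₁) ((1 - 8 * c.δ) * ((c.L : ℝ) / 2) * c.κ) :=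
  hLayer_toClusterTower_of_stepGen F K G D sp hrestr (stepGen_of_stepGenT F K G D sp c hL hLc hN Tm hgenT) hA hr₁ hrate hsmall hrenew hD

end Recursion

/-! ## §3 L05 AT THE ADMISSIBLE PAIRING OF RECORD for the generated tower from (GEN-T) -/

section Admissible

open scoped Matrix.Norms.L2Operator

variable (F : T4Family) (M N k : ℕ) [NeZero M] (sp : (k j : ℕ) → (domSys (F.P k) M j).Dom → Set (CPair (F.P k) (MatA N)))
  (gauge : GaugeField (F.P k) 0 (Node00.SU N) → GaugeField (F.P k) 0 (Node00.SU N) → ℝ) (hg : ∀ U U', 0 ≤ gauge U U')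
  (T₀ : GaugeField (F.P (k + 1)) 0 (Node00.SU N) → GaugeField (F.P k) 0 (Node00.SU N))
  (hT₀ : ∀ U : GaugeField (F.P (k + 1)) 0 (Node00.SU N),
    (∀ (j : ℕ) (Y : (domSys (F.P (k + 1)) M j).Dom), ofBackgroundC (ιSU N) U ∈ sp (k + 1) j Y) →
      ∀ (j : ℕ) (Y : (domSys (F.P k) M j).Dom), ofBackgroundC (ιSU N) (T₀ U) ∈ sp k j Y)

open Classical in
/-- **★ L05 OF THE END AT THE ADMISSIBLE PAIRING OF RECORD FOR THE GENERATED TOWER, FROM (GEN-T) + ONE NUMERICS BUNDLE ALONE**: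
`DecayBound ((LevelPairing.ofRecordAdm F M N k sp gauge hg T₀ hT₀).EA (toClusterTower G)) (Window γ) E₀ r₁` — readings in the spaces BY TYPE, no
per-step data, no embedding clause (file 17 §3 ∘ §1). [cite: Balaban1987RG1, (0.25) p.257, (1.18) p.263 and Thm 1 p.259; Balaban1988RG2Cluster, (2.14) p.15, (2.26) p.17, p.22] -/
theorem decayBound_EA_ofRecordAdm_toClusterTower_of_stepGenT (G : GenTower (F.P k) (MatA N) M) (D : Set ℂ) {E₀ r₁ γ : ℝ}
    (hrestr : ∀ m, W1.SpRestr (sp k (m + 1)))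
    (c : B13.Consts) {L : ℕ} [NeZero L] (hL : 8 ≤ c.L) (hLc : c.L = L) {a a₂ a₂' a₅ Aabs : ℝ}
    (hN : Lemma3Numerics c M ((c.L : ℝ) / 2) a a₂ a₂' a₅ Aabs)
    (Tm : (m : ℕ) → ℂ → OlderTerms (F.P k) (MatA N) M m → (Z : TDom 4 (domCount (F.P k) M (m + 1))) →
      Finset (TDom 4 (L * domCount (F.P k) M (m + 1))) × Finset (TBond 4 M (L * domCount (F.P k) M (m + 1))) → CPair (F.P k) (MatA N) → ℂ)
    (hgenT : ∀ m : ℕ, ∀ t ∈ D, ∀ old : OlderTerms (F.P k) (MatA N) M m,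
      (∀ (j : Fin (m + 1)) (Y : (domSys (F.P k) M j).Dom), ∀ ψ ∈ sp k j Y,
          ‖old j Y ψ‖ ≤ E₀ * Real.exp (-(r₁ * (domSys (F.P k) M j).dj Y))) →
      (∀ (j : Fin (m + 1)) (Y : (domSys (F.P k) M j).Dom), AnalyticOnNhd ℂ (old j Y) (sp k j Y)) →
      (∀ (Z : (domSys (F.P k) M (m + 1)).Dom), ∀ i ∈ (G m).idx Z, AnalyticOnNhd ℂ (fun φ => (G m).T i t old φ) (sp k (m + 1) Z)) ∧
      (∀ (Z : (domSys (F.P k) M (m + 1)).Dom) (φ : CPair (F.P k) (MatA N)), φ ∈ sp k (m + 1) Z →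
          ‖(G m).H t old φ Z‖ ≤ ∑ τ ∈ terms L M Z, ‖Tm m t old Z τ φ‖) ∧
      (∀ (Z : (domSys (F.P k) M (m + 1)).Dom) (φ : CPair (F.P k) (MatA N)), φ ∈ sp k (m + 1) Z → ∀ τ ∈ terms L M Z,
          ‖Tm m t old Z τ φ‖ ≤ weight L M c Z a τ * Real.exp (a₅ * ((Z.1).card : ℝ))))
    (hr₁ : 0 ≤ r₁) (hA : 0 ≤ c.C3act * c.ε₁) (hrate : r₁ + 2 * (64 * Real.log 162) + 2 ≤ (1 - 8 * c.δ) * ((c.L : ℝ) / 2) * c.κ)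
    (hsmall : c.C3act * c.ε₁ * Real.exp (5 * r₁ + 1) * K₀ 64 8 * 9 * 64 < 1)
    (hrenew : Real.exp 1 * 9 * 64 * K₀ 64 8 ^ 2 * (c.C3act * c.ε₁) ≤ E₀) (hD : ∀ s ∈ Ioc (0 : ℝ) γ, ((s : ℝ) : ℂ) ∈ D) :
    DecayBound ((LevelPairing.ofRecordAdm F M N k sp gauge hg T₀ hT₀).EA (toClusterTower G)) (Window γ) E₀ r₁ :=
  decayBound_EA_ofRecordAdm_toClusterTower_of_stepGen F M N k sp gauge hg T₀ hT₀ G D hrestr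
    (stepGen_of_stepGenT F k G D (sp k) c hL hLc hN Tm hgenT) hA hr₁ hrate hsmall hrenew hD

end Admissible

/-! ## §4 [I] p. 266 for the generated tower with node00-def-W1's admissibility hypothesis DISCHARGED: three schemas on the generator, no tower hypothesis -/

section Road3

variable (F : T4Family) (K : ℕ) {𝔸 : Type} [NormedRing 𝔸] [NormedAlgebra ℂ 𝔸] {M : ℕ}

open Classical in
/-- **★ ANALYTICITY IN EVERY YOUNG COUPLING FOR THE GENERATED TOWER FROM THREE PER-GENERATOR SCHEMAS** ([I] p. 266 «E^{(j)}, β_j are analytic functions of the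
effective coupling constants», read on the object as `W1.AnalyticInEachOfRecord (toClusterTower G) W I sp`): node00-def-W1's `analyticInEachOfRecord_toClusterTower`
with its admissibility bookkeeping `hAdm : RecAdmissible G D Adm` DISCHARGED by file 17's `recAdmissible_of_stepGen` at the class `Adm k = {old | (1.18)(E₀,r₁) ∧
analytic on the tables}` — so the hypotheses are (GEN) (NODE A's majorant per generator), (A-last) and (A-prop) (node00-def-W1's ROAD-3 schemas per generator)
at that class, the tables' restriction property and the numerics; nothing is assumed of the tower. [cite: Balaban1987RG1, p.266 (paragraph after (2.9)), p.263 and Thm 1 p.259; Balaban1988RG2Cluster, (1.41) p.11, (2.14) p.15 and p.22] -/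
theorem analyticInEachOfRecord_toClusterTower_of_stepGen (G : GenTower (F.P K) 𝔸 M) (D : Set ℂ)
    (sp : (j : ℕ) → (domSys (F.P K) M j).Dom → Set (CPair (F.P K) 𝔸)) {A R r₁ E₀ : ℝ} (hrestr : ∀ k, W1.SpRestr (sp (k + 1)))
    (hgen : ∀ k : ℕ, ∀ t ∈ D, ∀ old : OlderTerms (F.P K) 𝔸 M k,
      (∀ (j : Fin (k + 1)) (Y : (domSys (F.P K) M j).Dom), ∀ ψ ∈ sp j Y,
          ‖old j Y ψ‖ ≤ E₀ * Real.exp (-(r₁ * (domSys (F.P K) M j).dj Y))) →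
      (∀ (j : Fin (k + 1)) (Y : (domSys (F.P K) M j).Dom), AnalyticOnNhd ℂ (old j Y) (sp j Y)) →
      (∀ Z : (domSys (F.P K) M (k + 1)).Dom, AnalyticOnNhd ℂ (fun φ => (G k).H t old φ Z) (sp (k + 1) Z)) ∧
      (∀ (Z : (domSys (F.P K) M (k + 1)).Dom), ∀ φ ∈ sp (k + 1) Z,
          ‖(G k).H t old φ Z‖ ≤ A * Real.exp (-(R * (domSys (F.P K) M (k + 1)).dj Z))))
    (hA : 0 ≤ A) (hr₁ : 0 ≤ r₁) (hrate : r₁ + 2 * (64 * Real.log 162) + 2 ≤ R)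
    (hsmall : A * Real.exp (5 * r₁ + 1) * K₀ 64 8 * 9 * 64 < 1) (hrenew : Real.exp 1 * 9 * 64 * K₀ 64 8 ^ 2 * A ≤ E₀)
    (hlast : ∀ k, (G k).AnalyticInLast D {old : OlderTerms (F.P K) 𝔸 M k |
      (∀ (j : Fin (k + 1)) (Y : (domSys (F.P K) M j).Dom), ∀ ψ ∈ sp j Y,
          ‖old j Y ψ‖ ≤ E₀ * Real.exp (-(r₁ * (domSys (F.P K) M j).dj Y))) ∧
      (∀ (j : Fin (k + 1)) (Y : (domSys (F.P K) M j).Dom), AnalyticOnNhd ℂ (old j Y) (sp j Y))} (sp (k + 1)))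
    (hprop : ∀ k, (G k).PropagatesAnalyticity D {old : OlderTerms (F.P K) 𝔸 M k |
      (∀ (j : Fin (k + 1)) (Y : (domSys (F.P K) M j).Dom), ∀ ψ ∈ sp j Y,
          ‖old j Y ψ‖ ≤ E₀ * Real.exp (-(r₁ * (domSys (F.P K) M j).dj Y))) ∧
      (∀ (j : Fin (k + 1)) (Y : (domSys (F.P K) M j).Dom), AnalyticOnNhd ℂ (old j Y) (sp j Y))} (fun j => sp j) (sp (k + 1)))
    {W : Set (ℕ → ℝ)} {I : Set ℝ} (hW : ∀ h ∈ W, ∀ n, ((h n : ℝ) : ℂ) ∈ D) (hI : ∀ s ∈ I, ((s : ℝ) : ℂ) ∈ D) :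
    AnalyticInEachOfRecord (toClusterTower G) W I sp :=
  analyticInEachOfRecord_toClusterTower G (recAdmissible_of_stepGen F K G D sp hrestr hgen hA hr₁ hrate hsmall hrenew) hlast hprop hW hI

end Road3

/-! ## §5 (1.17) for the generated tower from (GEN) on the `ρ`-thickened tables (file 13's Cauchy margin) -/

section Seventeen

variable (F : T4Family) (K : ℕ) {𝔸 : Type} [NormedRing 𝔸] [NormedAlgebra ℂ 𝔸] {M : ℕ}

open Classical in
/-- **(1.17) AT THE TABLE FOR THE GENERATED TOWER FROM (GEN) ON ITS `ρ`-THICKENING** ([I] p. 263's margin): IF (GEN) holds for the THICKENED table family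
`j X ↦ thickening ρ (sp j X)` (radius `ρ > 0`; it inherits the restriction property, file 13's `spRestr_thickening`), THEN file 17's
`hLayer_toClusterTower_of_stepGen` gives the (2.38) pair of `toClusterTower G` at every step on the thickened tables and file 13's
`termDerivBound_of_bound238_thickening` gives `W1.TermDerivBound (toClusterTower G) (Window γ) sp (e·9·64·K₀(64,8)²·A ∕ ρ) r₁` — with file 17 §2, all THREE
printed inductive assumptions of [I] p. 263 for the generated tower from the one per-generator schema. [cite: Balaban1987RG1, (1.17)-(1.18) p.263 and Thm 1 p.259; Balaban1988RG2Cluster, p.22] -/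
theorem termDerivBound_toClusterTower_of_stepGen_thickening (G : GenTower (F.P K) 𝔸 M) (D : Set ℂ)
    (sp : (j : ℕ) → (domSys (F.P K) M j).Dom → Set (CPair (F.P K) 𝔸)) {ρ A R r₁ E₀ γ : ℝ} (hρ : 0 < ρ) (hrestr : ∀ k, W1.SpRestr (sp (k + 1)))
    (hgen : ∀ k : ℕ, ∀ t ∈ D, ∀ old : OlderTerms (F.P K) 𝔸 M k,
      (∀ (j : Fin (k + 1)) (Y : (domSys (F.P K) M j).Dom), ∀ ψ ∈ thickening ρ (sp j Y),
          ‖old j Y ψ‖ ≤ E₀ * Real.exp (-(r₁ * (domSys (F.P K) M j).dj Y))) →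
      (∀ (j : Fin (k + 1)) (Y : (domSys (F.P K) M j).Dom), AnalyticOnNhd ℂ (old j Y) (thickening ρ (sp j Y))) →
      (∀ Z : (domSys (F.P K) M (k + 1)).Dom, AnalyticOnNhd ℂ (fun φ => (G k).H t old φ Z) (thickening ρ (sp (k + 1) Z))) ∧
      (∀ (Z : (domSys (F.P K) M (k + 1)).Dom), ∀ φ ∈ thickening ρ (sp (k + 1) Z),
          ‖(G k).H t old φ Z‖ ≤ A * Real.exp (-(R * (domSys (F.P K) M (k + 1)).dj Z))))
    (hA : 0 ≤ A) (hr₁ : 0 ≤ r₁) (hrate : r₁ + 2 * (64 * Real.log 162) + 2 ≤ R)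
    (hsmall : A * Real.exp (5 * r₁ + 1) * K₀ 64 8 * 9 * 64 < 1) (hrenew : Real.exp 1 * 9 * 64 * K₀ 64 8 ^ 2 * A ≤ E₀)
    (hD : ∀ s ∈ Ioc (0 : ℝ) γ, ((s : ℝ) : ℂ) ∈ D) :
    TermDerivBound (toClusterTower G) (Window γ) sp (Real.exp 1 * 9 * 64 * K₀ 64 8 ^ 2 * A / ρ) r₁ :=
  have hall := hLayer_toClusterTower_of_stepGen F K G D (fun j X => thickening ρ (sp j X)) (fun k => spRestr_thickening (hrestr k) ρ) hgen
    hA hr₁ hrate hsmall hrenew hD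
  termDerivBound_of_bound238_thickening F K (toClusterTower G) (Window γ) (fun k => box γ k) sp hρ (fun m _ hg => restrictPrefix_mem_box hg m)
    hrestr (fun k => (hall k).1) (fun k => (hall k).2) hA hr₁ hrate hsmall.le

end Seventeen

end Summit.QuantumFields.YangMills.BalabanUVNodes.N18HLayerW1RecursionTerms

end
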